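import Literature.NumberTheory.LFunctions.FordLemma46
import Literature.NumberTheory.LFunctions.VinogradovKorobovIntermediateClosure
import Literature.NumberTheory.LFunctions.KadiriTestFunction
import Literature.NumberTheory.LFunctions.SmoothedExplicitFormulaShift
import HarnessLib

/-!
# Lemma 6.1 and Theorem 1.4 of Mossinghoff–Trudgian–Yang from Patel's bound (3.3) and the Riemann–von Mangoldt formula (3.8) only

Topic `Literature/NumberTheory/LFunctions`, family RH (explicit Vinogradov–Korobov zero-free
regions). Everything in this file is PROVED; no definition, no named fact.

The tree's closing corollaries for the named facts
`Literature.NumberTheory.LFunctions.zero_inequality_intermediate_mossinghoff_trudgian_yang`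
(**Lemma 6.1**) and `Literature.NumberTheory.LFunctions.zero_free_region_intermediate_mossinghoff_trudgian_yang`
(**Theorem 1.4**) of Mossinghoff–Trudgian–Yang (Res. Number Theory 10 (2024) = arXiv:2212.06867)
— `…_of_detector` in `VinogradovKorobovIntermediateClosure.lean` — rest on three inputs: `h42`
(MTY Lemma 4.2 = Ford's Lemmas 4.5–4.6 at `η = ½`, for every `IsFordSmoothing f (1/2) D`),
Patel's (3.3) (`zeta_half_line_patel`) and (3.8) (`zetaZeroCount_hasanalizade_shen_wong`). This
file DISCHARGES `h42` for the smoothing actually used, Ford's kernel `f(u) = λe^{λu}w(λu)`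
(`fordSmoothF θ λ`):

* `isSmoothedEFTest_fordSmoothF` — Ford's kernel is an admissible smoothing for the tree's
  smoothed explicit formula (`IsSmoothedEFTest`): on `[0, ∞)` it is the exponential twist
  (`IsSmoothedEFTest.expTwist`, `δ = −λ`) of Kadiri's test function `kadiriTest θ λ`
  (`KadiriTest.isSmoothedEFTest`), with the same `C²` profile;
* `h42_fordSmoothF` — **MTY Lemma 4.2 at `η = ½` for Ford's kernel**: `FordDetectorIneqRaw` for
  every `t ≥ 1000` and every bound of the strict far-zero sums, and `K(1) ≤ F(0) + 1.8D`
  (`FordL46.fordDetectorIneqRaw_of_admissible`, `FordL46.re_fordK_one_le'`);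
* `mtyDetectorRHS_nonneg_from_kernel` — the §6 assembly `mtyDetectorRHS_nonneg_from` of
  `VinogradovKorobovIntermediateAssembly.lean` VERBATIM, with its hypothesis `h42` asked only of
  Ford's kernels `fordSmoothF θ λ` (the only smoothings it is applied to);
* `zero_inequality_intermediate_mossinghoff_trudgian_yang_of_patel_hsw` — **Lemma 6.1 (the
  named fact) from `zeta_half_line_patel` and `zetaZeroCount_hasanalizade_shen_wong` alone**;
* `zero_free_region_intermediate_mossinghoff_trudgian_yang_of_patel_hsw` — **Theorem 1.4 as
  printed (the named fact, threshold `exp 1000`) from the same two named facts.**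

So the in-tree proof of Theorem 1.4 is now complete up to exactly the two printed external
inputs (3.3) and (3.8), each a named fact with its own discharge unit.

## References

* M. J. Mossinghoff, T. S. Trudgian, A. Yang, *Explicit zero-free regions for the Riemann
  zeta-function*, Res. Number Theory 10 (2024) = arXiv:2212.06867: Lemma 4.2, (3.3), (3.8),
  Lemma 6.1, Theorem 1.4. [MossinghoffTrudgianYangRNT2024]
* K. Ford, *Zero-free regions for the Riemann zeta function*, Number Theory for the Millennium II
  (Urbana 2000), A K Peters 2002 = arXiv:1910.08205: Lemmas 4.5–4.6, (6.6), §9.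
  [Ford2002Millennium]
-/

noncomputable section

open Complex Real MeasureTheory Finset Set Filter
open scoped Topology

namespace Literature.NumberTheory.LFunctions

/-! ## Ford's kernel is an admissible smoothing -/

/-- On `[0, ∞)` Ford's kernel `f(u) = λe^{λu}w(λu)` is the exponential twist (`δ = −λ`) of
Kadiri's test function `u ↦ λ w(λ max(u,0))`. [cite: Ford2002Millennium, (6.6)] -/
theorem fordSmoothF_eq_expTwist_kadiriTest (θ : ℝ) {lam u : ℝ} (hu : 0 ≤ u) :
    fordSmoothF θ lam u = expTwist (kadiriTest θ lam) (-lam) u := by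
  simp only [fordSmoothF, expTwist, kadiriTest, max_eq_left hu, fordW_eq_fordKernelW, neg_mul,
    neg_neg]
  ring

/-- **Ford's kernel `f(u) = λe^{λu}w(λu)` (`0 < θ < π/2`, `λ > 0`) is an admissible smoothing for
the smoothed explicit formula** (`IsSmoothedEFTest`), with the `C²` profile of
`(KadiriTest.isSmoothedEFTest …).expTwist (−λ)` and `x₀ = d₁(θ)/λ = 2θ cot θ/λ`.
[cite: Ford2002Millennium, Lemma 4.5 (Remarks) and (6.6)] -/
theorem isSmoothedEFTest_fordSmoothF {θ lam : ℝ} (hθ : 0 < θ) (hθ' : θ < π / 2) (hlam : 0 < lam) :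
    IsSmoothedEFTest (fordSmoothF θ lam)
      (fun t ↦ mtyH1 lam θ t * Real.exp (-(-lam * t)))
      (fun t ↦ (mtyH1Deriv lam θ t - -lam * mtyH1 lam θ t) * Real.exp (-(-lam * t)))
      (fun t ↦ (mtyH1Deriv2 lam θ t - 2 * -lam * mtyH1Deriv lam θ t + (-lam) ^ 2 * mtyH1 lam θ t) *
        Real.exp (-(-lam * t)))
      (mtyD1 θ / lam) := by
  have hK := (KadiriTest.isSmoothedEFTest hθ hθ' hlam).expTwist (-lam)
  exact
    { cont := (contDiff_fordSmoothF (fordKernelFacts hθ hθ').contDiff lam).continuous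
      x₀_nonneg := hK.x₀_nonneg
      eqOn := fun t ht ↦ (fordSmoothF_eq_expTwist_kadiriTest θ ht.1).trans (hK.eqOn t ht)
      eq_zero := fun u hu ↦
        (fordSmoothF_eq_expTwist_kadiriTest θ (hK.x₀_nonneg.trans hu)).trans (hK.eq_zero u hu)
      hasDerivAt := hK.hasDerivAt
      hasDerivAt' := hK.hasDerivAt'
      cont'' := hK.cont''
      p_x₀ := hK.p_x₀
      p'_x₀ := hK.p'_x₀ }

/-! ## MTY Lemma 4.2 at `η = ½` for Ford's kernel -/

/-- **MTY Lemma 4.2 = Ford's Lemma 4.6 at `η = ½` for Ford's kernel `f = fordSmoothF θ λ`**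
(`0 < θ < π/2`, `λ > 0`), for every `F₀`-constant `D` with `IsFordSmoothing f (1/2) D`: for all
`t ≥ 1000` and every bound `S` of the strict far-zero sums, `FordDetectorIneqRaw (1/2) f D t S`;
and `K(1) ≤ F(0) + 1.8 D`. This is the hypothesis `h42` of the in-tree §6 assembly, for the
smoothings it is applied to. [cite: MossinghoffTrudgianYangRNT2024, Lemma 4.2]
[cite: Ford2002Millennium, Lemma 4.6] -/
theorem h42_fordSmoothF {θ : ℝ} (hθ : 0 < θ) (hθ' : θ < π / 2) {lam D : ℝ} (hlam : 0 < lam)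
    (hfS : IsFordSmoothing (fordSmoothF θ lam) (1 / 2) D) :
    (∀ t : ℝ, 1000 ≤ t → ∀ S : ℝ, FordFarZeroSumLT t (1 / 2) S →
        FordDetectorIneqRaw (1 / 2) (fordSmoothF θ lam) D t S) ∧
      (fordK (fordSmoothF θ lam) 1).re ≤ (fordLaplace (fordSmoothF θ lam) 0).re + 1.8 * D := by
  have h := isSmoothedEFTest_fordSmoothF hθ hθ' hlam
  have hf0 : 0 ≤ fordSmoothF θ lam 0 := hfS.nonneg 0
  have hD := hfS.laplace_bound
  exact ⟨fun t ht S hS ↦ FordL46.fordDetectorIneqRaw_of_admissible h (by norm_num) le_rfl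
      (by linarith) hf0 hD (fun T hT ↦ hS T hT),
    FordL46.re_fordK_one_le' h (by norm_num) hf0 hD⟩

/-! ## The §6 assembly with `h42` asked of Ford's kernels only -/

/-- **The right-hand side of (6.8) is `≥ 0`** — `mtyDetectorRHS_nonneg_from` of
`VinogradovKorobovIntermediateAssembly.lean` verbatim (proof included), except that the smoothed
zero detector `h42` is asked only of Ford's kernels `fordSmoothF θ λ`, `λ > 0`, the only
smoothings the proof applies it to. [cite: MossinghoffTrudgianYangRNT2024, Lemma 6.1 (proof: (6.2)–(6.9))]
[cite: Ford2002Millennium, §9 ((9.2) and the display after it)] -/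
theorem mtyDetectorRHS_nonneg_from_kernel (Far : ℝ → ℝ → ℝ → Prop) {θ : ℝ}
    (hθF : IsFordTheta (mtyB40 0) (mtyB40 1) θ) (hθ1 : 1.13331020 ≤ θ) (hθ2 : θ ≤ 1.13331021)
    (h42 : ∀ (lam D : ℝ), 0 < lam → IsFordSmoothing (fordSmoothF θ lam) (1 / 2) D →
      (∀ t : ℝ, 1000 ≤ t → ∀ S : ℝ, Far t (1 / 2) S →
        FordDetectorIneqRaw (1 / 2) (fordSmoothF θ lam) D t S) ∧
        (fordK (fordSmoothF θ lam) 1).re ≤ (fordLaplace (fordSmoothF θ lam) 0).re + 1.8 * D)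
    (hP : zeta_half_line_patel)
    {T₉₂ : ℝ} (h92 : ∀ t : ℝ, T₉₂ ≤ t → Far t (1 / 2)
      (3.2357 * Real.log t + 5.316 * Real.log (Real.log t) + 16.134 - 4 * fordN t (1 / 2)))
    {β t : ℝ} (ht : 10000 ≤ t) (ht92 : T₉₂ ≤ t) (hzero : riemannZeta (β + t * I) = 0)
    (hβ : 1 - 1 / 1712 ≤ β)
    {lam : ℝ} (hlam : 0 < lam) (hlam1 : lam ≤ 1 - β) (hrect : ZetaZeroFreeRect lam t (40 * t + 1)) :
    0 ≤ mtyDetectorRHS θ β t lam := by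
  have hJ : ∀ t : ℝ, 100 ≤ t → 1 / 2 * fordLogZetaIntegral (1 / 2) t (1 / π) ≤ mtyJ t :=
    fun t ht ↦ half_fordLogZetaIntegral_half_le_mtyJ hP ht
  have h32 := mty_threeHalves_line_bound_mtyB40
  have hπ := Real.pi_pos
  have hπ4 := Real.pi_lt_d2
  have hb0 : mtyB40 0 = 1 := mtyB40_zero
  have hθ := hθF.1
  have hθ' := hθF.2.1
  rw [hb0] at hθF
  have hK : FordKernelFacts θ := fordKernelFacts hθ hθ'
  have hb1 := mtyB40_one_ge
  have hbnn := isNonnegTrigPoly_mtyB40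
  have hb1nn : 0 ≤ mtyB40 1 := hbnn.1 1
  have hβ1 : 0 < 1 - β := one_sub_pos_of_riemannZeta_eq_zero hzero
  -- `R = 1/(2(1−β)) − 1 ≥ 855`
  set R : ℝ := 1 / (2 * (1 - β)) - 1 with hRdef
  have hR1 : R + 1 = 1 / (2 * (1 - β)) := by rw [hRdef]; ring
  have hR : 855 ≤ R := by
    have h1 : (856 : ℝ) ≤ 1 / (2 * (1 - β)) := by
      rw [le_div_iff₀ (by positivity)]; linarith
    linarith
  have hR3 : (3 : ℝ) ≤ R := by linarith
  have hR0 : 0 < R := by linarith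
  have htan : Real.tan θ < R := (tan_fordTheta_lt_three hb1 hθF).trans_le hR3
  have hw0 : 0 < fordSmoothW0 θ := fordSmoothW0_pos hθ hθ'
  have hw0k : fordKernelW θ 0 = fordSmoothW0 θ := fordKernelW_zero hθ hθ'
  have hf0 : fordSmoothF θ lam 0 = lam * fordSmoothW0 θ := by rw [fordSmoothF_zero, hw0k]
  have hf0pos : 0 < fordSmoothF θ lam 0 := by rw [hf0]; positivity
  have hC5 : fordC5 θ R ≤ 1.0117 := VK.fordC5_le_of_ge_855 hθ1 hθ2 hR
  have hc4 : 0 ≤ fordC5 θ R := by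
    have := fordH_nonneg_of_pos hθ hθ' hR0
    unfold fordC5; positivity
  set D : ℝ := 1.0146 * lam * fordSmoothF θ lam 0 with hDdef
  have hD0 : 0 ≤ D := by positivity
  -- `(R + 1)λ ≤ ½` and `λ ≤ (½)/(R + 1) = 1 − β`
  have hhalf : (1 / 2 : ℝ) / (R + 1) = 1 - β := by
    rw [hR1]; field_simp
  have hlam2 : lam ≤ (1 / 2 : ℝ) / (R + 1) := by rw [hhalf]; exact hlam1
  have hRl : (R + 1) * lam ≤ 1 / 2 := by
    have hR10 : 0 < R + 1 := by linarith
    rw [le_div_iff₀ hR10] at hlam2; linarith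
  -- `f` is an admissible smoothing with `D = 1.0146 λ f(0)` from `η = ½` on
  have hfS : IsFordSmoothing (fordSmoothF θ lam) (1 / 2) D := by
    refine ⟨contDiff_fordSmoothF hK.contDiff lam, fordSmoothF_nonneg hθ hθ' hlam,
      ⟨2 * (θ * Real.cot θ) / lam, fun u hu ↦ fordSmoothF_eq_zero hθ hθ' hlam hu⟩, fun z hz hzη ↦ ?_⟩
    have h := norm_fordLaplace_fordSmoothF_sub_le hθ hθ' hR3 htan hK.closed_form hw0k hw0 hlam hz
      (hRl.trans hzη)
    refine h.trans ?_
    rw [hDdef]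
    have hz0 : 0 < ‖z‖ ^ 2 := by
      have : 0 < ‖z‖ := lt_of_lt_of_le (by norm_num) hzη
      positivity
    apply div_le_div_of_nonneg_right _ hz0.le
    have : fordC5 θ R ≤ 1.0146 := hC5.trans (by norm_num)
    have h0 : 0 ≤ lam * fordSmoothF θ lam 0 := by positivity
    nlinarith
  -- the zero-free rectangle: zeros near `1 + i(j+1)t` have `Re ρ ≤ 1 − λ`
  have hzeros : ∀ j : ℕ, j < 40 → ∀ ρ ∈ fordNearZeros (((j : ℝ) + 1) * t) (1 / 2), ρ.re ≤ 1 - lam := by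
    intro j hj ρ hρ
    rw [mem_fordNearZeros] at hρ
    by_contra hcon
    rw [not_le] at hcon
    have hre1 : ρ.re ≤ 1 := by
      by_contra h1
      exact riemannZeta_ne_zero_of_one_le_re (s := ρ) (not_le.1 h1).le hρ.1
    have hj' : (j : ℝ) + 1 ≤ 40 := by
      have : (j : ℝ) ≤ 39 := by exact_mod_cast Nat.lt_succ_iff.1 hj
      linarith
    have hj0 : (0 : ℝ) ≤ j := j.cast_nonneg
    have him : |((j : ℝ) + 1) * t - ρ.im| ≤ 1 / 2 := by
      have h := Complex.abs_im_le_norm (1 + ((((j : ℝ) + 1) * t : ℝ) : ℂ) * I - ρ)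
      have e : (1 + ((((j : ℝ) + 1) * t : ℝ) : ℂ) * I - ρ).im = ((j : ℝ) + 1) * t - ρ.im := by simp
      rw [e] at h
      exact h.trans hρ.2
    rw [abs_le] at him
    have ht0 : 0 ≤ t := by linarith only [ht]
    have hjt : 0 ≤ (j : ℝ) * t := mul_nonneg hj0 ht0
    have hjt2 : ((j : ℝ) + 1) * t ≤ 40 * t := mul_le_mul_of_nonneg_right hj' ht0
    refine hrect ρ hcon hre1 ?_ ?_ hρ.1
    · nlinarith only [him.2, hjt, ht]
    · linarith only [him.1, hjt2]
  -- the far-zero bound and the detector at heights `(j+1)t`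
  set Sf : ℝ → ℝ := fun τ ↦ 3.2357 * Real.log τ + 5.316 * Real.log (Real.log τ) + 16.134
    - 4 * fordN τ (1 / 2) with hSf
  have hdet : ∀ j : ℕ, j < 40 →
      FordDetectorIneqRaw (1 / 2) (fordSmoothF θ lam) D (((j : ℝ) + 1) * t) (Sf (((j : ℝ) + 1) * t)) := by
    intro j hj
    have hj0 : (0 : ℝ) ≤ j := j.cast_nonneg
    have h1 : t ≤ ((j : ℝ) + 1) * t := le_mul_of_one_le_left (by linarith only [ht]) (by linarith only [hj0])
    have hτ : 10000 ≤ ((j : ℝ) + 1) * t := by linarith only [h1, ht]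
    exact (h42 lam D hlam hfS).1 _ (by linarith only [hτ]) _
      (h92 _ (by linarith only [h1, ht92]))
  have hK1 : (fordK (fordSmoothF θ lam) 1).re ≤ (fordLaplace (fordSmoothF θ lam) 0).re + 1.8 * D :=
    (h42 lam D hlam hfS).2
  -- `F(0) = W(-1)`
  have hF0 : (fordLaplace (fordSmoothF θ lam) 0).re = fordLaplaceW θ (-1) := by
    rw [fordLaplace_fordSmoothF hlam, zero_div, zero_sub, show (-1 : ℂ) = ((-1 : ℝ) : ℂ) by push_cast; ring,
      fordLaplaceWC_ofReal, Complex.ofReal_re]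
  -- positivity (6.1)/(6.3)
  have hpos := fordK_trigPoly_nonneg' (fordSmoothF_nonneg hθ hθ' hlam)
    (fun u hu ↦ fordSmoothF_eq_zero hθ hθ' hlam hu) hbnn t
  rw [hb0] at hpos
  -- logs and `J`
  have hL : ∀ j : ℕ, j < 40 → Real.log (((j : ℝ) + 1) * t) ≤ Real.log (40 * t + 1) ∧
      Real.log (Real.log (((j : ℝ) + 1) * t)) ≤ Real.log (Real.log (40 * t + 1)) :=
    fun j hj ↦ ⟨(mty_logs_le ht hj).2.1, (mty_logs_le ht hj).2.2⟩
  have hJmono : ∀ j : ℕ, j < 40 → mtyJ (((j : ℝ) + 1) * t) ≤ mtyJ (40 * t + 1) := by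
    intro j hj
    unfold mtyJ
    linarith [(hL j hj).1]
  have hJj : ∀ j : ℕ, j < 40 →
      1 / 2 * fordLogZetaIntegral (1 / 2) (((j : ℝ) + 1) * t) (1 / π) ≤ mtyJ (((j : ℝ) + 1) * t) := by
    intro j hj
    have hj0 : (0 : ℝ) ≤ j := j.cast_nonneg
    refine hJ _ ?_
    have h1 : t ≤ ((j : ℝ) + 1) * t := le_mul_of_one_le_left (by linarith only [ht]) (by linarith only [hj0])
    linarith only [h1, ht]
  -- summing the detector inequalities over `j`
  have hSK : ∑ j ∈ Finset.range 40, mtyB40 (j + 1) *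
        (fordK (fordSmoothF θ lam) (1 + ((((j : ℝ) + 1) * t : ℝ) : ℂ) * I)).re
      ≤ mtyB40Sum * (fordSmoothF θ lam 0 * mtyJ (40 * t + 1)
          + D * (1.8 + Real.log (40 * t + 1) / 3 + 3.2357 * Real.log (40 * t + 1)
            + 5.316 * Real.log (Real.log (40 * t + 1)) + 16.134))
        - ∑ j ∈ Finset.range 40, mtyB40 (j + 1) * fordNearSum (fordSmoothF θ lam) (1 / 2) (((j : ℝ) + 1) * t)
        - fordSmoothF θ lam 0 / 2 *
            ∑ j ∈ Finset.range 40, mtyB40 (j + 1) *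
              fordLogZetaIntegral (3 / 2) (((j : ℝ) + 1) * t) (1 / π)
        - 4 * D * ∑ j ∈ Finset.range 40, mtyB40 (j + 1) * fordN (((j : ℝ) + 1) * t) (1 / 2) := by
    have hbSdef : ∑ j ∈ Finset.range 40, mtyB40 (j + 1) = mtyB40Sum := rfl
    rw [Finset.mul_sum, Finset.mul_sum, ← hbSdef, Finset.sum_mul, ← Finset.sum_sub_distrib,
      ← Finset.sum_sub_distrib, ← Finset.sum_sub_distrib]
    refine Finset.sum_le_sum fun j hj ↦ ?_
    rw [Finset.mem_range] at hj
    have h := hdet j hj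
    unfold FordDetectorIneqRaw at h
    rw [show (1 : ℝ) - 1 / 2 = 1 / 2 by norm_num, show (1 : ℝ) + 1 / 2 = 3 / 2 by norm_num,
      show (2 : ℝ) * (1 / 2) / π = 1 / π by ring, show (4 : ℝ) * (1 / 2) = 2 by norm_num] at h
    exact detector_step_half hf0pos.le hD0 (hbnn.1 _) (hL j hj).1 (hL j hj).2 (hJj j hj) (hJmono j hj) h
  -- the `3/2`-line
  have hSI := h32 t
  rw [hb0] at hSI
  -- the near-zero sums
  set c : ℝ := π / (2 * (1 / 2)) * lam with hcdef
  set bd : ℝ := fordVBound θ R c with hbddef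
  have hSNS : -(∑ j ∈ Finset.range 40, mtyB40 (j + 1) *
        fordNearSum (fordSmoothF θ lam) (1 / 2) (((j : ℝ) + 1) * t))
      ≤ -(mtyB40 1 * (fordV θ c (((π / (2 * (1 / 2)) * (1 - β) : ℝ)) : ℂ)).re)
        + bd * ∑ j ∈ Finset.range 40, mtyB40 (j + 1) * fordN (((j : ℝ) + 1) * t) (1 / 2) := by
    -- the generic heights `(j+1)t`, `j ≥ 1`
    have hrest : -(∑ j ∈ Finset.range 39, mtyB40 (j + 1 + 1) *
          fordNearSum (fordSmoothF θ lam) (1 / 2) ((((j + 1 : ℕ) : ℝ) + 1) * t))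
        ≤ bd * ∑ j ∈ Finset.range 39, mtyB40 (j + 1 + 1) * fordN ((((j + 1 : ℕ) : ℝ) + 1) * t) (1 / 2) := by
      rw [Finset.mul_sum, ← Finset.sum_neg_distrib]
      refine Finset.sum_le_sum fun j hj ↦ ?_
      rw [Finset.mem_range] at hj
      have hbj : 0 ≤ mtyB40 (j + 1 + 1) := hbnn.1 _
      have h := neg_fordNearSum_le hθ hθ' hR3 htan hK hlam (by norm_num : (0 : ℝ) < 1 / 2) hlam2
        (hzeros (j + 1) (by omega))
      rw [← hcdef, ← hbddef] at h
      have h' := mul_le_mul_of_nonneg_left h hbj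
      linarith only [h']
    -- the height `t` of the zero itself
    have hz0 : ∀ ρ ∈ fordNearZeros t (1 / 2), ρ.re ≤ 1 - lam := by
      have h0 := hzeros 0 (by norm_num)
      simp only [Nat.cast_zero, zero_add, one_mul] at h0
      exact h0
    have h0 := neg_fordNearSum_le_of_zero hθ hθ' hR3 htan hK hlam (by norm_num : (0 : ℝ) < 1 / 2)
      hlam2 hzero (by linarith only [hβ]) hz0
    rw [← hcdef, ← hbddef] at h0
    have h0' := mul_le_mul_of_nonneg_left h0 hb1nn
    rw [Finset.sum_range_succ', Finset.sum_range_succ' (fun j ↦ mtyB40 (j + 1) * fordN (((j : ℝ) + 1) * t) (1 / 2))]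
    simp only [Nat.cast_zero, zero_add, one_mul]
    linarith only [hrest, h0']
  -- the cancellation `c₅ c² w(0) ≤ 4D` ((6.9), corrected: `C₅(R) − 1/R ≤ 1.0146`)
  have hbd : bd ≤ 4 * D := by
    rw [hbddef, fordVBound, hDdef, hf0, hcdef]
    have h1 : fordC5 θ R - 1 / R ≤ 1.0146 := by
      have : 0 < 1 / R := by positivity
      linarith only [hC5, this]
    have h2 : 0 ≤ lam ^ 2 * fordSmoothW0 θ := by positivity
    have h3 := mul_le_mul_of_nonneg_right h1 h2
    have e : 4 / π ^ 2 * (fordC5 θ R - 1 / R) * (π / (2 * (1 / 2)) * lam) ^ 2 * fordSmoothW0 θ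
        = 4 * (fordC5 θ R - 1 / R) * (lam ^ 2 * fordSmoothW0 θ) := by
      have hπ0 : π ≠ 0 := hπ.ne'
      rw [show π / (2 * (1 / 2)) * lam = π * lam by ring, mul_pow,
        show 4 / π ^ 2 * (fordC5 θ R - 1 / R) * (π ^ 2 * lam ^ 2) * fordSmoothW0 θ
          = (π ^ 2 / π ^ 2) * (4 * (fordC5 θ R - 1 / R) * (lam ^ 2 * fordSmoothW0 θ)) by ring,
        div_self (pow_ne_zero 2 hπ0), one_mul]
    rw [e]
    have e2 : 4 * (1.0146 * lam * (lam * fordSmoothW0 θ)) = 4 * 1.0146 * (lam ^ 2 * fordSmoothW0 θ) := by ring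
    rw [e2]
    linarith only [h3]
  have hSN : 0 ≤ ∑ j ∈ Finset.range 40, mtyB40 (j + 1) * fordN (((j : ℝ) + 1) * t) (1 / 2) :=
    Finset.sum_nonneg fun j _ ↦ mul_nonneg (hbnn.1 _) (fordN_nonneg _ _)
  -- the zero `β + it` itself: (6.7)
  have hx0 : 0 < π / (2 * (1 / 2)) * (1 - β) := by positivity
  have hx0' : π / (2 * (1 / 2)) * (1 - β) ≤ 1 / 20 := by
    have h1712 : 1 - β ≤ 1 / 1712 := by linarith only [hβ]
    calc π / (2 * (1 / 2)) * (1 - β) = π * (1 - β) := by ring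
      _ ≤ 3.15 * (1 / 1712) := mul_le_mul hπ4.le h1712 hβ1.le (by norm_num)
      _ ≤ 1 / 20 := by norm_num
  have hV0 : -(0.3334 * π ^ 2 * fordSmoothF θ lam 0 * (1 - β))
      + fordLaplaceW θ ((1 - β) / lam - 1)
      ≤ (fordV θ c (((π / (2 * (1 / 2)) * (1 - β) : ℝ)) : ℂ)).re := by
    have hcot := cot_sub_inv_ge_real_sharp hx0 hx0'
    have harg : (((π / (2 * (1 / 2)) * (1 - β) : ℝ) : ℂ)) / (c : ℂ) - 1 = (((1 - β) / lam - 1 : ℝ) : ℂ) := by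
      rw [hcdef]; push_cast
      have : (lam : ℂ) ≠ 0 := by exact_mod_cast hlam.ne'
      have : (π : ℂ) ≠ 0 := by exact_mod_cast hπ.ne'
      have : (2 : ℂ) ≠ 0 := by norm_num
      field_simp
    have hre : (fordV θ c (((π / (2 * (1 / 2)) * (1 - β) : ℝ)) : ℂ)).re
        = c * fordSmoothW0 θ * (Real.cot (π / (2 * (1 / 2)) * (1 - β)) - 1 / (π / (2 * (1 / 2)) * (1 - β)))
          + fordLaplaceW θ ((1 - β) / lam - 1) := by
      unfold fordV
      rw [harg, fordLaplaceWC_ofReal, Complex.add_re, ← Complex.ofReal_cot, ← Complex.ofReal_one,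
        ← Complex.ofReal_div, ← Complex.ofReal_sub, ← Complex.ofReal_mul, Complex.ofReal_re,
        Complex.ofReal_re]
    rw [hre, hf0, hcdef]
    have h1 := mul_le_mul_of_nonneg_left hcot (by positivity : 0 ≤ π / (2 * (1 / 2)) * lam * fordSmoothW0 θ)
    have e : π / (2 * (1 / 2)) * lam * fordSmoothW0 θ * (-0.3334 * (π / (2 * (1 / 2)) * (1 - β)))
        = -(0.3334 * π ^ 2 * (lam * fordSmoothW0 θ) * (1 - β)) := by
      ring
    linarith only [h1, e]
  -- assemble
  unfold mtyDetectorRHS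
  rw [hw0k, hb0, ← hF0]
  exact assembly_half_final hf0 hDdef hb1nn hf0pos.le hpos hK1 hSK hSI hSNS hbd hSN hV0



/-! ## Lemma 6.1 and Theorem 1.4 from (3.3) and (3.8) -/

/-- **Lemma 6.1 from every threshold `T ≥ 10⁴`, `T ≥ exp 999`, from Patel's (3.3) and (3.8)**
(`zeroInequalityIntermediateFrom_of_ford` with `h42` discharged for Ford's kernel and `h92` =
(6.4) from (3.8), `farZeroSum_half_strict_of_hsw_exp999`). [cite: MossinghoffTrudgianYangRNT2024, Lemma 6.1] -/
theorem zeroInequalityIntermediateFrom_of_patel_hsw (hP : zeta_half_line_patel)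
    (hN : zetaZeroCount_hasanalizade_shen_wong) {T : ℝ} (hT : 10000 ≤ T) (hT' : Real.exp 999 ≤ T) :
    ZeroInequalityIntermediateFrom T := by
  obtain ⟨θ, hθ, h1, h2⟩ := VK.exists_isFordTheta_mtyB40
  refine zeroInequalityIntermediateFrom_of_detector hθ h1 h2 (by linarith) ?_
  intro β t ht hz hβ lam hl0 hl1 hrect
  exact mtyDetectorRHS_nonneg_from_kernel FordFarZeroSumLT hθ h1 h2
    (fun lam D hlam hfS ↦ h42_fordSmoothF hθ.1 hθ.2.1 hlam hfS) hP
    (fun t ht T hT ↦ farZeroSum_half_strict_of_hsw_exp999 hN t ht T hT)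
    (hT.trans ht) (hT'.trans ht) hz hβ hl0 hl1 hrect

/-- **Lemma 6.1 of Mossinghoff–Trudgian–Yang — the named fact
`zero_inequality_intermediate_mossinghoff_trudgian_yang` — from Patel's sub-Weyl bound (3.3) and
the Riemann–von Mangoldt formula (3.8) alone** (the tree's two named facts `zeta_half_line_patel`,
`zetaZeroCount_hasanalizade_shen_wong`; everything else in the printed proof — Ford's Lemmas 2.2,
3.1–3.4, 4.4–4.6, 5.1, §§6–7, MTY Lemmas 4.2–4.4, (6.2)–(6.11) — is a theorem of the tree).
[cite: MossinghoffTrudgianYangRNT2024, Lemma 6.1] -/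
theorem zero_inequality_intermediate_mossinghoff_trudgian_yang_of_patel_hsw
    (hP : zeta_half_line_patel) (hN : zetaZeroCount_hasanalizade_shen_wong) :
    zero_inequality_intermediate_mossinghoff_trudgian_yang :=
  zeroInequalityIntermediateFrom_exp_iff.1
    (zeroInequalityIntermediateFrom_of_patel_hsw hP hN
      (VK.exp_999_ge.trans (Real.exp_le_exp.2 (by norm_num))) (Real.exp_le_exp.2 (by norm_num)))

/-- **Theorem 1.4 of Mossinghoff–Trudgian–Yang as printed — the named fact
`zero_free_region_intermediate_mossinghoff_trudgian_yang` (threshold `exp 1000`) — from Patel's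
(3.3) and (3.8) alone.** [cite: MossinghoffTrudgianYangRNT2024, Theorem 1.4] -/
theorem zero_free_region_intermediate_mossinghoff_trudgian_yang_of_patel_hsw
    (hP : zeta_half_line_patel) (hN : zetaZeroCount_hasanalizade_shen_wong) :
    zero_free_region_intermediate_mossinghoff_trudgian_yang :=
  zero_free_region_intermediate_mossinghoff_trudgian_yang_of_from
    (zeroInequalityIntermediateFrom_of_patel_hsw hP hN
      (by linarith [VK.exp_999_ge, VK.exp_1000_sub_ge]) (by linarith [VK.exp_1000_sub_ge]))

end Literature.NumberTheory.LFunctions
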